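import Mathlib
import HarnessLib
import Summits.HubbardSuperconductivity.HubbardSuperconductivity.Theorems.KLProgrammeKLRegimeSplitLegSlice
import Summits.HubbardSuperconductivity.HubbardSuperconductivity.Theorems.KLProgrammeKLRegimeSplitLegVertex

/-!
# Route `KLProgramme` — crux K3 split, ENGINE child (stmt-HubbardSuperconductivity-19662 / gen 3 `KLRegimeEngineV8`): the PER-LEG SIZE of the
# (D) leg dressing, assembled — slice covariance entry (`…SplitLegSlice`) × two-leg vertex from the history slots (`…SplitLegVertex`) on the
# counted window (`…SplitLegCount`) (cell gate-hubbard-kl, seat hubbard-kl-k3c2-p3, row «leg-dress bar»)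

For an external leg `ℓ = (±ω₀, k⃗, σ)` of a value clause at step `n ≥ 1`, the one-particle-reducible dressing factor is the slice-covariance entry on
the two charge labels of `ℓ` times the two-leg vertex of the scale-`(n−1)` action at `ℓ`.  From the three landed inputs:
* the entry VANISHES unless the cutoff weight of `ℓ` changes between `Λ_n` and `Λ_{n−1}` (`klld_covSliceCT_apply_eq_zero`), and then `ℓ` is COUNTED
  by `legSliceCountT … n` (`klld_counted_of_weight_ne`) and lies in the previous shell `S_{n−1}` (`klld_mem_klShell_pred_of_weight_ne`, here);
* on the window `‖entry‖ ≤ 2βL²·|Δw|/t < 4βL²/Λ_n` (`klld_norm_covSliceCT_mode_omega0_le`, `klld_inv_radius_lt_of_weight_ne`);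
* on `S_{n−1}`, under (E0) + `RenormalisedAtF R (n−1)` + `TwoLegSlopes R (n−1)`: `‖Σ_{n−1}(ω₀,k⃗,σ)‖ ≤ cr|U|Λ²_{n−1}/e₀ + cz|U|(Λ_{n−1} + π/β)`
  (`klld_norm_selfEnergy_le_uniform`);
we get THE PER-LEG DRESSING SIZE (`klld_leg_dressing_le`):

  `‖entry‖ · ‖Σ_{n−1}(ω₀,k⃗,σ)‖ ≤ βL² · (64·cr·|U|·4^{−n} + 16·cz·|U| + 4·cz·|U|·(π/β)/Λ_n)`,

zero off the counted window — i.e. `βL²` (BGM's momentum-space normalisation, cancelled by the kernels' `(βL²)^{-1}`) times: the RESIDUAL part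
`64·cr·|U|·4^{−n}` (`legDressBarQ`'s quadratic profile once multiplied by the value `≤ Klam|U|`: `Q.CR ≥ 64·cr/Klam`), the SLOPE part `16·cz·|U|`
and the FIELD-STRENGTH part `4cz|U|(π/β)/Λ_n` (`≤ 4^{-(n_β−n)}`-small above the thermal layer, `…SplitThermalLayer`) — the two `R`-linear readings
an engine proof replaces by its own second-order sizes (Δ15 (z): cubic part of `legDressBarQ` / `thermalBar`).  And summed over the four legs of a
configuration with the count: `Σ_i ‖ζ_i‖ ≤ (per-leg size)·legSliceCountT … n legs` (`klld_sum_leg_dressing_le`).  Pure consequences of the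
tree's covariance definitions and the slot texts; nothing about the model beyond its free covariance is asserted.
-/

noncomputable section

namespace Summit.HubbardSuperconductivity.HubbardSuperconductivity.Theorems.KLRegimeSplit

set_option linter.dupNamespace false -- summit = problem name (single-conjunct summit), D-0017

open Real Finset Literature.MathematicalPhysics.QuantumLattice Literature.Probability.LatticeModels
open Summit.HubbardSuperconductivity.HubbardSuperconductivity.Theorems.KLProgrammeLegKernels

section Model

variable {L M : ℕ} [NeZero L] [NeZero M]

/-- **A dressed leg lies in the previous shell**: if the cutoff weight of `(ω₀, k⃗)` changes between `Λ_n` and `Λ_{n−1}` (`n ≥ 1`), then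
`|e_K(k⃗)| ≤ Λ_{n−1}`, i.e. `k⃗ ∈ S_{n−1} = klShell … (n − 1)` (the slice support gives `t < Λ_{n−1}` and `|e_K| ≤ t`). -/
theorem klld_mem_klShell_pred_of_weight_ne (β μ : ℝ) (K : TrigPolyC4v) {n : ℕ} (k : TorusSite 2 L)
    (h : hubbardCutoffWeightCT L M β μ K (klScale klE0 n) (omega0 M, k) ≠
      hubbardCutoffWeightCT L M β μ K (klScale klE0 (n - 1)) (omega0 M, k)) :
    k ∈ klShell L μ K (n - 1) := by
  rw [klld_weight_omega0, klld_weight_omega0] at h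
  have hΛ := klth_klScale_pos n
  have hΛΛ' : klScale klE0 n ≤ klScale klE0 (n - 1) := klld_klScale_anti (Nat.sub_le n 1)
  obtain ⟨-, hhi⟩ := klld_slice_support hΛ hΛΛ' (sq_nonneg _) h
  have hr2 : klLegRadius L β μ K k ^ 2 = (Real.pi / β) ^ 2 + nambuXiCT L μ K k ^ 2 := by
    rw [klLegRadius, Real.sq_sqrt (by positivity)]
  have he2 : nambuXiCT L μ K k ^ 2 ≤ klScale klE0 (n - 1) ^ 2 := by nlinarith [sq_nonneg (Real.pi / β)]
  have he : |nambuXiCT L μ K k| ≤ klScale klE0 (n - 1) :=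
    abs_le_of_sq_le_sq' he2 (klth_klScale_pos _).le |>.elim (fun h1 h2 => abs_le.mpr ⟨h1, h2⟩)
  unfold klShell momentumShell
  exact Finset.mem_filter.mpr ⟨Finset.mem_univ _, he⟩

/-- **THE PER-LEG DRESSING SIZE.**  At step `n ≥ 1`, for an external leg `(ω₀, k⃗, σ)` with its two charge labels `c, c'`, under the history
slots (E0) `SelfEnergySymmetric … (n−1)`, `RenormalisedAtF … R (n−1)`, `TwoLegSlopes R … (n−1)` (`cr, cz ≥ 0`, `β > 0`):
`‖(C^K_{>Λ_n} − C^K_{>Λ_{n−1}})((ω₀,k⃗,σ,c),(ω₀,k⃗,σ,c'))‖ · ‖Σ_{n−1}(ω₀,k⃗,σ)‖ ≤ βL²·(64·cr·|U|·4^{−n} + 16·cz·|U| + 4·cz·|U|·(π/β)/Λ_n)`. -/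
theorem klld_leg_dressing_le {β U μ : ℝ} (hβ : 0 < β) {K : TrigPolyC4v} {R : RenConsts} (hcr : 0 ≤ R.cr) (hcz : 0 ≤ R.cz)
    {n : ℕ} (hn : 1 ≤ n) (hE0 : SelfEnergySymmetric L M β U μ K (n - 1)) (hren : RenormalisedAtF L M β U μ K R (n - 1))
    (hsl : TwoLegSlopes L M R β U μ K (n - 1)) (k : TorusSite 2 L) (σ c c' : Fin 2) :
    ‖hubbardCovSliceCT L M β μ 0 K (klScale klE0 n) (klScale klE0 (n - 1)) (((omega0 M, k), σ), c) (((omega0 M, k), σ), c')‖ *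
        ‖klSelfEnergy L M β U μ K klE0 (n - 1) (omega0 M, k) σ‖ ≤
      β * (L : ℝ) ^ 2 *
        (64 * R.cr * |U| * ((4 : ℝ) ^ n)⁻¹ + 16 * R.cz * |U| + 4 * R.cz * |U| * ((Real.pi / β) / klScale klE0 n)) := by
  have hΛ := klth_klScale_pos n
  have hβL : 0 ≤ β * (L : ℝ) ^ 2 := by positivity
  have hU := abs_nonneg U
  have hπβ : 0 ≤ Real.pi / β := (div_pos Real.pi_pos hβ).le
  have hRHS : 0 ≤ β * (L : ℝ) ^ 2 *
      (64 * R.cr * |U| * ((4 : ℝ) ^ n)⁻¹ + 16 * R.cz * |U| + 4 * R.cz * |U| * ((Real.pi / β) / klScale klE0 n)) := by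
    positivity
  by_cases hw : hubbardCutoffWeightCT L M β μ K (klScale klE0 n) (omega0 M, k) =
      hubbardCutoffWeightCT L M β μ K (klScale klE0 (n - 1)) (omega0 M, k)
  · -- off the window the entry vanishes
    have h0 := klld_covSliceCT_apply_eq_zero L M β μ 0 K (klScale klE0 n) (klScale klE0 (n - 1))
      (((omega0 M, k), σ), c) (((omega0 M, k), σ), c') hw hw
    rw [h0, norm_zero, zero_mul]
    exact hRHS
  · -- on the window: entry `≤ 2βL²·(2/Λ_n)`, the leg sits in `S_{n-1}`, vertex bound from the slots
    have hentry := klld_norm_covSliceCT_mode_omega0_le (M := M) hβ μ K (klScale klE0 n) (klScale klE0 (n - 1)) k σ c c'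
    have hrad := klld_inv_radius_lt_of_weight_ne L M β μ K n k hw
    have hw1 := salmhoferCutoff_mem_Icc (((Real.pi / β) ^ 2 + nambuXiCT L μ K k ^ 2) / klScale klE0 n ^ 2)
    have hw2 := salmhoferCutoff_mem_Icc (((Real.pi / β) ^ 2 + nambuXiCT L μ K k ^ 2) / klScale klE0 (n - 1) ^ 2)
    have habs : |hubbardCutoffWeightCT L M β μ K (klScale klE0 n) (omega0 M, k) -
        hubbardCutoffWeightCT L M β μ K (klScale klE0 (n - 1)) (omega0 M, k)| ≤ 1 := by
      simp only [hubbardCutoffWeightCT, matsubaraFreq_omega0] at *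
      rw [abs_le]; constructor <;> linarith [hw1.1, hw1.2, hw2.1, hw2.2]
    have hinv0 : 0 ≤ (klLegRadius L β μ K k)⁻¹ := inv_nonneg.mpr (Real.sqrt_nonneg _)
    have hE : ‖hubbardCovSliceCT L M β μ 0 K (klScale klE0 n) (klScale klE0 (n - 1)) (((omega0 M, k), σ), c)
        (((omega0 M, k), σ), c')‖ ≤ 2 * (β * (L : ℝ) ^ 2) * (2 / klScale klE0 n) := by
      refine hentry.trans (mul_le_mul_of_nonneg_left ?_ (by positivity))
      calc _ ≤ 1 * (klLegRadius L β μ K k)⁻¹ := mul_le_mul_of_nonneg_right habs hinv0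
        _ ≤ 2 / klScale klE0 n := by rw [one_mul]; exact hrad.le
    have hshell := klld_mem_klShell_pred_of_weight_ne β μ K k hw
    have hV := klld_norm_selfEnergy_le_uniform hβ hcz hE0 hren hsl hshell σ
    have hV0 : 0 ≤ ‖klSelfEnergy L M β U μ K klE0 (n - 1) (omega0 M, k) σ‖ := norm_nonneg _
    have hE0' : 0 ≤ 2 * (β * (L : ℝ) ^ 2) * (2 / klScale klE0 n) := by positivity
    -- arithmetic of the product of the two majorants
    have hres := klld_residual_dressing_arith R.cr U hn
    have hslo := klld_dressing_slope_part R.cz U hn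
    calc _ ≤ (2 * (β * (L : ℝ) ^ 2) * (2 / klScale klE0 n)) *
          (R.cr * |U| * klScale klE0 (n - 1) ^ 2 / klE0 + R.cz * |U| * (klScale klE0 (n - 1) + Real.pi / β)) :=
          mul_le_mul hE hV hV0 hE0'
      _ = β * (L : ℝ) ^ 2 * (2 * (2 / klScale klE0 n * (R.cr * |U| * klScale klE0 (n - 1) ^ 2 / klE0)) +
            2 * (2 / klScale klE0 n * (R.cz * |U| * klScale klE0 (n - 1))) +
              4 * R.cz * |U| * ((Real.pi / β) / klScale klE0 n)) := by ring
      _ = _ := by rw [hres, hslo]; ring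

/-- Abstract bookkeeping: nonnegative-majorant sums over a counted sub-family. -/
theorem klld_sum_le_mul_of_card_le {ι : Type*} [Fintype ι] {f : ι → ℝ} {p : ι → Prop} {inst : DecidablePred p} {z : ℝ}
    (hz : 0 ≤ z) (h0 : ∀ i, ¬p i → f i = 0) (hb : ∀ i, f i ≤ z) {c : ℕ}
    (hc : (@Finset.filter ι p inst Finset.univ).card ≤ c) :
    ∑ i, f i ≤ z * (c : ℝ) := by
  have hsplit : ∑ i, f i = ∑ i ∈ @Finset.filter ι p inst Finset.univ, f i := by
    rw [← @Finset.sum_filter_add_sum_filter_not _ _ _ Finset.univ p inst]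
    have : ∑ i ∈ Finset.univ.filter (fun i => ¬p i), f i = 0 :=
      Finset.sum_eq_zero fun i hi => h0 i (Finset.mem_filter.mp hi).2
    rw [this, add_zero]
  rw [hsplit]
  calc ∑ i ∈ @Finset.filter ι p inst Finset.univ, f i ≤ ∑ _i ∈ @Finset.filter ι p inst Finset.univ, z :=
        Finset.sum_le_sum fun i _ => hb i
    _ = z * ((@Finset.filter ι p inst Finset.univ).card : ℝ) := by rw [Finset.sum_const, nsmul_eq_mul, mul_comm]
    _ ≤ z * (c : ℝ) := mul_le_mul_of_nonneg_left (by exact_mod_cast hc) hz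

/-- **The four legs of a configuration, summed with the count**: the per-leg dressing sizes of the legs `k_i`, `i : Fin 4`, add up to at most
the per-leg majorant times `legSliceCountT … n legs` (legs whose weight does not change contribute `0`; the others are counted). -/
theorem klld_sum_leg_dressing_le {β U μ : ℝ} (hβ : 0 < β) {K : TrigPolyC4v} {R : RenConsts} (hcr : 0 ≤ R.cr) (hcz : 0 ≤ R.cz)
    {n : ℕ} (hn : 1 ≤ n) (hE0 : SelfEnergySymmetric L M β U μ K (n - 1)) (hren : RenormalisedAtF L M β U μ K R (n - 1))
    (hsl : TwoLegSlopes L M R β U μ K (n - 1)) (k : Fin 4 → TorusSite 2 L) (σ c c' : Fin 4 → Fin 2) :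
    ∑ i : Fin 4, ‖hubbardCovSliceCT L M β μ 0 K (klScale klE0 n) (klScale klE0 (n - 1)) (((omega0 M, k i), σ i), c i)
        (((omega0 M, k i), σ i), c' i)‖ * ‖klSelfEnergy L M β U μ K klE0 (n - 1) (omega0 M, k i) (σ i)‖ ≤
      β * (L : ℝ) ^ 2 *
          (64 * R.cr * |U| * ((4 : ℝ) ^ n)⁻¹ + 16 * R.cz * |U| + 4 * R.cz * |U| * ((Real.pi / β) / klScale klE0 n)) *
        (legSliceCountT L β μ K n k : ℝ) := by
  have hΛ := klth_klScale_pos n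
  have hπβ : 0 ≤ Real.pi / β := (div_pos Real.pi_pos hβ).le
  have hz0 : 0 ≤ β * (L : ℝ) ^ 2 *
      (64 * R.cr * |U| * ((4 : ℝ) ^ n)⁻¹ + 16 * R.cz * |U| + 4 * R.cz * |U| * ((Real.pi / β) / klScale klE0 n)) := by
    positivity
  have hb := fun i => klld_leg_dressing_le (L := L) (M := M) hβ hcr hcz hn hE0 hren hsl (k i) (σ i) (c i) (c' i)
  have h0 : ∀ i : Fin 4, ¬ (hubbardCutoffWeightCT L M β μ K (klScale klE0 n) (omega0 M, k i) ≠
        hubbardCutoffWeightCT L M β μ K (klScale klE0 (n - 1)) (omega0 M, k i)) →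
      ‖hubbardCovSliceCT L M β μ 0 K (klScale klE0 n) (klScale klE0 (n - 1)) (((omega0 M, k i), σ i), c i)
          (((omega0 M, k i), σ i), c' i)‖ * ‖klSelfEnergy L M β U μ K klE0 (n - 1) (omega0 M, k i) (σ i)‖ = 0 := by
    intro i hi
    have hw : hubbardCutoffWeightCT L M β μ K (klScale klE0 n) (omega0 M, k i) =
        hubbardCutoffWeightCT L M β μ K (klScale klE0 (n - 1)) (omega0 M, k i) := not_not.mp hi
    rw [klld_covSliceCT_apply_eq_zero L M β μ 0 K (klScale klE0 n) (klScale klE0 (n - 1)) (((omega0 M, k i), σ i), c i)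
      (((omega0 M, k i), σ i), c' i) hw hw, norm_zero, zero_mul]
  have hcount := klld_card_dressed_le_countT L M β μ K hn k
  exact klld_sum_le_mul_of_card_le hz0 h0 hb hcount

end Model

end Summit.HubbardSuperconductivity.HubbardSuperconductivity.Theorems.KLRegimeSplit

end
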